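import Literature.Topology.FourManifolds.CappellShanesonClassGroupThirty
import Literature.Topology.FourManifolds.CappellShanesonClassGroupThirtyCls
import Literature.Topology.FourManifolds.CappellShanesonTotallyReal
import Literature.Topology.FourManifolds.CappellShanesonClassGroupTwelve
import Literature.Topology.FourManifolds.CappellShanesonClassGroupFifteen
import HarnessLib

/-!
# Trace `30`: the class group, the cover of `C(ℤ[Θ₃₀])`, Gompf's conjecture for the traces `30` and `-25`

Part 'Main' of the certified class-group computation for the trace `30` field behind
Kim–Yamada's Theorem B (`GompfConjectureForTrace 30` and, by Theorem A, `-25`), serving the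
named fact
`Literature.Topology.FourManifolds.kimYamada2023_nonempty_diffeomorph_sphere_four_of_trace_mem_Icc`
(`CappellShaneson.lean`; M. H. Kim, S. Yamada, Kyungpook Math. J. 63 (2023) 373–411 =
arXiv:1707.03860, Cor. C). The computation is split over several files only because of the
proposal size limit: `…ClassGroupThirty.lean` (discriminant, `𝓞 K = ℤ[θ]`, the primes of small norm), `…ClassGroupThirtyRel<k>.lean` (two-ideal relations with certified generators and the non-vanishing of the generators), `…ClassGroupThirtyCls.lean` (the class of every small prime in terms of the generator(s), the order relations), `…ClassGroupThirtyMain.lean` (generation of the class group by Minkowski's bound, the cover of `C(ℤ[Θ])` by standard-matrix representatives, Gompf's conjecture for the two traces). (File generated from a certified computation; every relation is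
checked by the Lean kernel; no named fact is introduced, D-0026.)

## References

* [KimYamada2023] M. H. Kim, S. Yamada, Kyungpook Math. J. 63 (2023) 373–411 (arXiv:1707.03860):
  §2.3 (Prop. 2.14), §6.1 (Lemma 6.1 and the proof of Thm. B), Thm. A.
* [Marcus2018] D. A. Marcus, *Number Fields*, 2nd ed., Ch. 3, Thm. 27 (Dedekind–Kummer); Ch. 5,
  Cor. 2 of Thm. 37 (Minkowski bound) and the class-group computations after it.
-/

noncomputable section

open Set Polynomial Module NumberField Ideal
open scoped NumberField MatrixGroups nonZeroDivisors
open Literature.LinearAlgebra.Matrix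

namespace Literature.Topology.FourManifolds

section Field

variable {K : Type*} [Field K] [NumberField K] {θ : K}

set_option maxHeartbeats 2000000 in
/-- **Every ideal class of the trace `30` field is a power `aʳ`, `0 ≤ r < 8`, of `a = [(5, θ - 2)]`,
represented by the ideals listed** (so the class number divides `8`). Proof: `d_K = 566977`,
`⌊M_K⌋ ≤ 167`, Dedekind–Kummer at `p ≤ 167`, and the class of every small prime computed above
from two-ideal relations with certified generators. [cite: KimYamada2023, §6.1 (proof of Thm. B)] -/
theorem classGroup_mem_thirty (hθ : aeval θ (csPoly 30) = 0) (h3 : finrank ℚ K = 3)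
    (C : ClassGroup (𝓞 K)) :
    C = 1 ∨
      C = ClassGroup.mk0 ⟨span {(5 : 𝓞 K), thetaInt hθ - 2}, (span_pair_ofNat_mem_nonZeroDivisors (nat_lit 5) (thetaInt hθ - 2))⟩ ∨
      C = ClassGroup.mk0 ⟨span {(17 : 𝓞 K), thetaInt hθ - 15}, (span_pair_ofNat_mem_nonZeroDivisors (nat_lit 17) (thetaInt hθ - 15))⟩ ∨
      C = ClassGroup.mk0 ⟨span {(11 : 𝓞 K), thetaInt hθ - 8}, (span_pair_ofNat_mem_nonZeroDivisors (nat_lit 11) (thetaInt hθ - 8))⟩ ∨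
      C = ClassGroup.mk0 ⟨span {(7 : 𝓞 K), thetaInt hθ - 4}, (span_pair_ofNat_mem_nonZeroDivisors (nat_lit 7) (thetaInt hθ - 4))⟩ ∨
      C = ClassGroup.mk0 ⟨span {(13 : 𝓞 K), thetaInt hθ - 5}, (span_pair_ofNat_mem_nonZeroDivisors (nat_lit 13) (thetaInt hθ - 5))⟩ ∨
      C = ClassGroup.mk0 ⟨span {(11 : 𝓞 K), thetaInt hθ - 9}, (span_pair_ofNat_mem_nonZeroDivisors (nat_lit 11) (thetaInt hθ - 9))⟩ ∨
      C = ClassGroup.mk0 ⟨span {(11 : 𝓞 K), thetaInt hθ - 2}, (span_pair_ofNat_mem_nonZeroDivisors (nat_lit 11) (thetaInt hθ - 2))⟩ := by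
  classical
  obtain ⟨a, ha⟩ : ∃ a : ClassGroup (𝓞 K), ClassGroup.mk0 ⟨span {(5 : 𝓞 K), thetaInt hθ - 2}, (span_pair_ofNat_mem_nonZeroDivisors (nat_lit 5) (thetaInt hθ - 2))⟩ = a := ⟨_, rfl⟩
  have ham : a ^ (8 : ℤ) = 1 := by rw [← ha]; exact pow_order_thirty hθ
  let H : Subgroup (ClassGroup (𝓞 K)) := Subgroup.zpowers a
  have hprinc : ∀ (P : Ideal (𝓞 K)) (hP0 : P ∈ (Ideal (𝓞 K))⁰) (x : 𝓞 K), P = span {x} →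
      ClassGroup.mk0 ⟨P, hP0⟩ ∈ H := by
    intro P hP0 x hPx
    have : ClassGroup.mk0 ⟨P, hP0⟩ = 1 :=
      (ClassGroup.mk0_eq_one_iff hP0).mpr ⟨⟨x, by rw [hPx, submodule_span_eq]⟩⟩
    rw [this]
    exact H.one_mem
  -- Minkowski: `⌊M_K⌋ ≤ 167`
  have hd : ((|NumberField.discr K| : ℤ) : ℝ) ≤ (566977 : ℕ) := by
    rw [discr_eq_thirty hθ h3]
    norm_num
  have hfloor := floor_minkowskiBound_le_cubic_real h3 (nrComplexPlaces_eq_zero_of_csPoly hθ h3 (by norm_num))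
    hd (s := 753) (U := 167) (by norm_num) (by norm_num) (by norm_num)
  have htop : H = ⊤ := by
    refine classGroup_subgroup_eq_top_of_primesOver H hfloor fun p hp hprime P hP0 hP hle => ?_
    have hpU : p ≤ 167 := (Finset.mem_Icc.mp hp).2
    have h1p : 1 ≤ p := (Finset.mem_Icc.mp hp).1
    interval_cases p
    · exact absurd hprime (by norm_num)
    · exact hprinc P hP0 _ (eq_span_of_inert_thirty hθ h3 (by norm_num) hP)
    · exact hprinc P hP0 _ (eq_span_of_inert_thirty hθ h3 (by norm_num) hP)
    · exact absurd hprime (by norm_num)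
    · -- `p = 5`
      rcases eq_P5_or_eq_Q5_thirty hθ h3 hP with h | h <;> subst h
      · rw [show ClassGroup.mk0 ⟨_, hP0⟩ = ClassGroup.mk0 ⟨span {(5 : 𝓞 K), thetaInt hθ - 2}, (span_pair_ofNat_mem_nonZeroDivisors (nat_lit 5) (thetaInt hθ - 2))⟩ from rfl, ha]
        exact Subgroup.mem_zpowers a
      · exact mem_zpowers_of_mk0_eq a (cls_Q5_thirty hθ) ha
    · exact absurd hprime (by norm_num)
    · -- `p = 7`
      rcases eq_P7_or_eq_Q7_thirty hθ h3 hP with h | h <;> subst h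
      · exact mem_zpowers_of_mk0_eq a (cls_P7_4_thirty hθ) ha
      · exact mem_zpowers_of_mk0_eq a (cls_Q7_thirty hθ) ha
    · exact absurd hprime (by norm_num)
    · exact absurd hprime (by norm_num)
    · exact absurd hprime (by norm_num)
    · -- `p = 11` (splits)
      rcases eq_P11_thirty hθ h3 hP with h | h | h <;> subst h
      · exact mem_zpowers_of_mk0_eq a (cls_P11_2_thirty hθ) ha
      · exact mem_zpowers_of_mk0_eq a (cls_P11_8_thirty hθ) ha
      · exact mem_zpowers_of_mk0_eq a (cls_P11_9_thirty hθ) ha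
    · exact absurd hprime (by norm_num)
    · -- `p = 13`
      have h := eq_span_pair_of_unique_root_thirty hθ h3 (Or.inl ⟨rfl, rfl⟩) hP hle
      simp only [Nat.cast_ofNat, Int.cast_ofNat] at h
      subst h
      exact mem_zpowers_of_mk0_eq a (cls_P13_5_thirty hθ) ha
    · exact absurd hprime (by norm_num)
    · exact absurd hprime (by norm_num)
    · exact absurd hprime (by norm_num)
    · -- `p = 17`
      have h := eq_span_pair_of_unique_root_thirty hθ h3 (Or.inr (Or.inl ⟨rfl, rfl⟩)) hP hle
      simp only [Nat.cast_ofNat, Int.cast_ofNat] at h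
      subst h
      exact mem_zpowers_of_mk0_eq a (cls_P17_15_thirty hθ) ha
    · exact absurd hprime (by norm_num)
    · exact hprinc P hP0 _ (eq_span_of_inert_thirty hθ h3 (by norm_num) hP)
    · exact absurd hprime (by norm_num)
    · exact absurd hprime (by norm_num)
    · exact absurd hprime (by norm_num)
    · exact hprinc P hP0 _ (eq_span_of_inert_thirty hθ h3 (by norm_num) hP)
    · exact absurd hprime (by norm_num)
    · exact absurd hprime (by norm_num)
    · exact absurd hprime (by norm_num)
    · exact absurd hprime (by norm_num)
    · exact absurd hprime (by norm_num)
    · -- `p = 29`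
      have h := eq_span_pair_of_unique_root_thirty hθ h3 (Or.inr (Or.inr (Or.inl ⟨rfl, rfl⟩))) hP hle
      simp only [Nat.cast_ofNat, Int.cast_ofNat] at h
      subst h
      exact mem_zpowers_of_mk0_eq a (cls_P29_10_thirty hθ) ha
    · exact absurd hprime (by norm_num)
    · exact hprinc P hP0 _ (eq_span_of_inert_thirty hθ h3 (by norm_num) hP)
    · exact absurd hprime (by norm_num)
    · exact absurd hprime (by norm_num)
    · exact absurd hprime (by norm_num)
    · exact absurd hprime (by norm_num)
    · exact absurd hprime (by norm_num)
    · -- `p = 37` (splits)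
      rcases eq_P37_thirty hθ h3 hP with h | h | h <;> subst h
      · exact mem_zpowers_of_mk0_eq a (cls_P37_5_thirty hθ) ha
      · exact mem_zpowers_of_mk0_eq a (cls_P37_7_thirty hθ) ha
      · exact mem_zpowers_of_mk0_eq a (cls_P37_18_thirty hθ) ha
    · exact absurd hprime (by norm_num)
    · exact absurd hprime (by norm_num)
    · exact absurd hprime (by norm_num)
    · -- `p = 41`
      have h := eq_span_pair_of_unique_root_thirty hθ h3 (Or.inr (Or.inr (Or.inr (Or.inl ⟨rfl, rfl⟩)))) hP hle
      simp only [Nat.cast_ofNat, Int.cast_ofNat] at h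
      subst h
      exact mem_zpowers_of_mk0_eq a (cls_P41_33_thirty hθ) ha
    · exact absurd hprime (by norm_num)
    · -- `p = 43`
      have h := eq_span_pair_of_unique_root_thirty hθ h3 (Or.inr (Or.inr (Or.inr (Or.inr (Or.inl ⟨rfl, rfl⟩))))) hP hle
      simp only [Nat.cast_ofNat, Int.cast_ofNat] at h
      subst h
      exact mem_zpowers_of_mk0_eq a (cls_P43_4_thirty hθ) ha
    · exact absurd hprime (by norm_num)
    · exact absurd hprime (by norm_num)
    · exact absurd hprime (by norm_num)
    · exact hprinc P hP0 _ (eq_span_of_inert_thirty hθ h3 (by norm_num) hP)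
    · exact absurd hprime (by norm_num)
    · exact absurd hprime (by norm_num)
    · exact absurd hprime (by norm_num)
    · exact absurd hprime (by norm_num)
    · exact absurd hprime (by norm_num)
    · exact hprinc P hP0 _ (eq_span_of_inert_thirty hθ h3 (by norm_num) hP)
    · exact absurd hprime (by norm_num)
    · exact absurd hprime (by norm_num)
    · exact absurd hprime (by norm_num)
    · exact absurd hprime (by norm_num)
    · exact absurd hprime (by norm_num)
    · -- `p = 59` (splits)
      rcases eq_P59_thirty hθ h3 hP with h | h | h <;> subst h
      · exact mem_zpowers_of_mk0_eq a (cls_P59_10_thirty hθ) ha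
      · exact mem_zpowers_of_mk0_eq a (cls_P59_35_thirty hθ) ha
      · exact mem_zpowers_of_mk0_eq a (cls_P59_44_thirty hθ) ha
    · exact absurd hprime (by norm_num)
    · -- `p = 61`
      have h := eq_span_pair_of_unique_root_thirty hθ h3 (Or.inr (Or.inr (Or.inr (Or.inr (Or.inr (Or.inl ⟨rfl, rfl⟩)))))) hP hle
      simp only [Nat.cast_ofNat, Int.cast_ofNat] at h
      subst h
      exact hprinc _ hP0 _ (P61_60_eq_thirty hθ)
    · exact absurd hprime (by norm_num)
    · exact absurd hprime (by norm_num)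
    · exact absurd hprime (by norm_num)
    · exact absurd hprime (by norm_num)
    · exact absurd hprime (by norm_num)
    · exact hprinc P hP0 _ (eq_span_of_inert_thirty hθ h3 (by norm_num) hP)
    · exact absurd hprime (by norm_num)
    · exact absurd hprime (by norm_num)
    · exact absurd hprime (by norm_num)
    · -- `p = 71`
      have h := eq_span_pair_of_unique_root_thirty hθ h3 (Or.inr (Or.inr (Or.inr (Or.inr (Or.inr (Or.inr (Or.inl ⟨rfl, rfl⟩))))))) hP hle
      simp only [Nat.cast_ofNat, Int.cast_ofNat] at h
      subst h
      exact mem_zpowers_of_mk0_eq a (cls_P71_34_thirty hθ) ha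
    · exact absurd hprime (by norm_num)
    · -- `p = 73`
      have h := eq_span_pair_of_unique_root_thirty hθ h3 (Or.inr (Or.inr (Or.inr (Or.inr (Or.inr (Or.inr (Or.inr (Or.inl ⟨rfl, rfl⟩)))))))) hP hle
      simp only [Nat.cast_ofNat, Int.cast_ofNat] at h
      subst h
      exact mem_zpowers_of_mk0_eq a (cls_P73_39_thirty hθ) ha
    · exact absurd hprime (by norm_num)
    · exact absurd hprime (by norm_num)
    · exact absurd hprime (by norm_num)
    · exact absurd hprime (by norm_num)
    · exact absurd hprime (by norm_num)
    · -- `p = 79` (splits)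
      rcases eq_P79_thirty hθ h3 hP with h | h | h <;> subst h
      · exact mem_zpowers_of_mk0_eq a (cls_P79_30_thirty hθ) ha
      · exact mem_zpowers_of_mk0_eq a (cls_P79_34_thirty hθ) ha
      · exact mem_zpowers_of_mk0_eq a (cls_P79_45_thirty hθ) ha
    · exact absurd hprime (by norm_num)
    · exact absurd hprime (by norm_num)
    · exact absurd hprime (by norm_num)
    · exact hprinc P hP0 _ (eq_span_of_inert_thirty hθ h3 (by norm_num) hP)
    · exact absurd hprime (by norm_num)
    · exact absurd hprime (by norm_num)
    · exact absurd hprime (by norm_num)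
    · exact absurd hprime (by norm_num)
    · exact absurd hprime (by norm_num)
    · exact hprinc P hP0 _ (eq_span_of_inert_thirty hθ h3 (by norm_num) hP)
    · exact absurd hprime (by norm_num)
    · exact absurd hprime (by norm_num)
    · exact absurd hprime (by norm_num)
    · exact absurd hprime (by norm_num)
    · exact absurd hprime (by norm_num)
    · exact absurd hprime (by norm_num)
    · exact absurd hprime (by norm_num)
    · exact hprinc P hP0 _ (eq_span_of_inert_thirty hθ h3 (by norm_num) hP)
    · exact absurd hprime (by norm_num)
    · exact absurd hprime (by norm_num)
    · exact absurd hprime (by norm_num)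
    · exact hprinc P hP0 _ (eq_span_of_inert_thirty hθ h3 (by norm_num) hP)
    · exact absurd hprime (by norm_num)
    · -- `p = 103`
      have h := eq_span_pair_of_unique_root_thirty hθ h3 (Or.inr (Or.inr (Or.inr (Or.inr (Or.inr (Or.inr (Or.inr (Or.inr (Or.inl ⟨rfl, rfl⟩))))))))) hP hle
      simp only [Nat.cast_ofNat, Int.cast_ofNat] at h
      subst h
      exact mem_zpowers_of_mk0_eq a (cls_P103_33_thirty hθ) ha
    · exact absurd hprime (by norm_num)
    · exact absurd hprime (by norm_num)
    · exact absurd hprime (by norm_num)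
    · -- `p = 107`
      have h := eq_span_pair_of_unique_root_thirty hθ h3 (Or.inr (Or.inr (Or.inr (Or.inr (Or.inr (Or.inr (Or.inr (Or.inr (Or.inr (Or.inl ⟨rfl, rfl⟩)))))))))) hP hle
      simp only [Nat.cast_ofNat, Int.cast_ofNat] at h
      subst h
      exact mem_zpowers_of_mk0_eq a (cls_P107_8_thirty hθ) ha
    · exact absurd hprime (by norm_num)
    · -- `p = 109`
      have h := eq_span_pair_of_unique_root_thirty hθ h3 (Or.inr (Or.inr (Or.inr (Or.inr (Or.inr (Or.inr (Or.inr (Or.inr (Or.inr (Or.inr (Or.inl ⟨rfl, rfl⟩))))))))))) hP hle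
      simp only [Nat.cast_ofNat, Int.cast_ofNat] at h
      subst h
      exact mem_zpowers_of_mk0_eq a (cls_P109_62_thirty hθ) ha
    · exact absurd hprime (by norm_num)
    · exact absurd hprime (by norm_num)
    · exact absurd hprime (by norm_num)
    · exact hprinc P hP0 _ (eq_span_of_inert_thirty hθ h3 (by norm_num) hP)
    · exact absurd hprime (by norm_num)
    · exact absurd hprime (by norm_num)
    · exact absurd hprime (by norm_num)
    · exact absurd hprime (by norm_num)
    · exact absurd hprime (by norm_num)
    · exact absurd hprime (by norm_num)
    · exact absurd hprime (by norm_num)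
    · exact absurd hprime (by norm_num)
    · exact absurd hprime (by norm_num)
    · exact absurd hprime (by norm_num)
    · exact absurd hprime (by norm_num)
    · exact absurd hprime (by norm_num)
    · exact absurd hprime (by norm_num)
    · exact hprinc P hP0 _ (eq_span_of_inert_thirty hθ h3 (by norm_num) hP)
    · exact absurd hprime (by norm_num)
    · exact absurd hprime (by norm_num)
    · exact absurd hprime (by norm_num)
    · -- `p = 131` (splits)
      rcases eq_P131_thirty hθ h3 hP with h | h | h <;> subst h
      · exact mem_zpowers_of_mk0_eq a (cls_P131_9_thirty hθ) ha
      · exact mem_zpowers_of_mk0_eq a (cls_P131_43_thirty hθ) ha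
      · exact mem_zpowers_of_mk0_eq a (cls_P131_109_thirty hθ) ha
    · exact absurd hprime (by norm_num)
    · exact absurd hprime (by norm_num)
    · exact absurd hprime (by norm_num)
    · exact absurd hprime (by norm_num)
    · exact absurd hprime (by norm_num)
    · -- `p = 137`
      have h := eq_span_pair_of_unique_root_thirty hθ h3 (Or.inr (Or.inr (Or.inr (Or.inr (Or.inr (Or.inr (Or.inr (Or.inr (Or.inr (Or.inr (Or.inr (Or.inl ⟨rfl, rfl⟩)))))))))))) hP hle
      simp only [Nat.cast_ofNat, Int.cast_ofNat] at h
      subst h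
      exact mem_zpowers_of_mk0_eq a (cls_P137_56_thirty hθ) ha
    · exact absurd hprime (by norm_num)
    · -- `p = 139`
      have h := eq_span_pair_of_unique_root_thirty hθ h3 (Or.inr (Or.inr (Or.inr (Or.inr (Or.inr (Or.inr (Or.inr (Or.inr (Or.inr (Or.inr (Or.inr (Or.inr (Or.inl ⟨rfl, rfl⟩))))))))))))) hP hle
      simp only [Nat.cast_ofNat, Int.cast_ofNat] at h
      subst h
      exact mem_zpowers_of_mk0_eq a (cls_P139_126_thirty hθ) ha
    · exact absurd hprime (by norm_num)
    · exact absurd hprime (by norm_num)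
    · exact absurd hprime (by norm_num)
    · exact absurd hprime (by norm_num)
    · exact absurd hprime (by norm_num)
    · exact absurd hprime (by norm_num)
    · exact absurd hprime (by norm_num)
    · exact absurd hprime (by norm_num)
    · exact absurd hprime (by norm_num)
    · -- `p = 149`
      have h := eq_span_pair_of_unique_root_thirty hθ h3 (Or.inr (Or.inr (Or.inr (Or.inr (Or.inr (Or.inr (Or.inr (Or.inr (Or.inr (Or.inr (Or.inr (Or.inr (Or.inr (Or.inl ⟨rfl, rfl⟩)))))))))))))) hP hle
      simp only [Nat.cast_ofNat, Int.cast_ofNat] at h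
      subst h
      exact mem_zpowers_of_mk0_eq a (cls_P149_108_thirty hθ) ha
    · exact absurd hprime (by norm_num)
    · exact hprinc P hP0 _ (eq_span_of_inert_thirty hθ h3 (by norm_num) hP)
    · exact absurd hprime (by norm_num)
    · exact absurd hprime (by norm_num)
    · exact absurd hprime (by norm_num)
    · exact absurd hprime (by norm_num)
    · exact absurd hprime (by norm_num)
    · -- `p = 157`
      have h := eq_span_pair_of_unique_root_thirty hθ h3 (Or.inr (Or.inr (Or.inr (Or.inr (Or.inr (Or.inr (Or.inr (Or.inr (Or.inr (Or.inr (Or.inr (Or.inr (Or.inr (Or.inr (Or.inl ⟨rfl, rfl⟩))))))))))))))) hP hle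
      simp only [Nat.cast_ofNat, Int.cast_ofNat] at h
      subst h
      exact hprinc _ hP0 _ (P157_3_eq_thirty hθ)
    · exact absurd hprime (by norm_num)
    · exact absurd hprime (by norm_num)
    · exact absurd hprime (by norm_num)
    · exact absurd hprime (by norm_num)
    · exact absurd hprime (by norm_num)
    · -- `p = 163`
      have h := eq_span_pair_of_unique_root_thirty hθ h3 (Or.inr (Or.inr (Or.inr (Or.inr (Or.inr (Or.inr (Or.inr (Or.inr (Or.inr (Or.inr (Or.inr (Or.inr (Or.inr (Or.inr (Or.inr (⟨rfl, rfl⟩)))))))))))))))) hP hle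
      simp only [Nat.cast_ofNat, Int.cast_ofNat] at h
      subst h
      exact mem_zpowers_of_mk0_eq a (cls_P163_85_thirty hθ) ha
    · exact absurd hprime (by norm_num)
    · exact absurd hprime (by norm_num)
    · exact absurd hprime (by norm_num)
    · exact hprinc P hP0 _ (eq_span_of_inert_thirty hθ h3 (by norm_num) hP)
  have hC : C ∈ H := by rw [htop]; exact Subgroup.mem_top C
  obtain ⟨k, rfl⟩ := Subgroup.mem_zpowers_iff.mp hC
  obtain ⟨q, r, hr, rfl⟩ : ∃ q r : ℤ, (r = 0 ∨ r = 1 ∨ r = 2 ∨ r = 3 ∨ r = 4 ∨ r = 5 ∨ r = 6 ∨ r = 7) ∧ k = 8 * q + r :=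
    ⟨k / 8, k % 8, by omega, by omega⟩
  rw [zpow_add, zpow_mul, ham, one_zpow, one_mul]
  rcases hr with rfl | rfl | rfl | rfl | rfl | rfl | rfl | rfl
  · exact Or.inl (zpow_zero a)
  · right; left
    rw [show (1 : ℤ) = 1 + 8 * (0) by norm_num, zpow_add, zpow_mul, ham, one_zpow, mul_one,
      zpow_one, ← ha]
  · right; right; left
    rw [show (2 : ℤ) = 2 + 8 * (0) by norm_num, zpow_add, zpow_mul, ham, one_zpow, mul_one,
      ← ha, ← cls_P17_15_thirty hθ]
  · right; right; right; left
    rw [show (3 : ℤ) = 3 + 8 * (0) by norm_num, zpow_add, zpow_mul, ham, one_zpow, mul_one,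
      ← ha, ← cls_P11_8_thirty hθ]
  · right; right; right; right; left
    rw [show (4 : ℤ) = -4 + 8 * (1) by norm_num, zpow_add, zpow_mul, ham, one_zpow, mul_one,
      ← ha, ← cls_P7_4_thirty hθ]
  · right; right; right; right; right; left
    rw [show (5 : ℤ) = -3 + 8 * (1) by norm_num, zpow_add, zpow_mul, ham, one_zpow, mul_one,
      ← ha, ← cls_P13_5_thirty hθ]
  · right; right; right; right; right; right; left
    rw [show (6 : ℤ) = -2 + 8 * (1) by norm_num, zpow_add, zpow_mul, ham, one_zpow, mul_one,
      ← ha, ← cls_P11_9_thirty hθ]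
  · right; right; right; right; right; right; right
    rw [show (7 : ℤ) = -1 + 8 * (1) by norm_num, zpow_add, zpow_mul, ham, one_zpow, mul_one,
      ← ha, ← cls_P11_2_thirty hθ]


end Field


/-! ### The ideal classes of `ℤ[X]/(f₃₀)` and Gompf's conjecture for the traces `30` and `-25` -/

section Matrices

set_option maxHeartbeats 1000000 in
/-- **The ideal classes of `ℤ[Θ₃₀] = ℤ[X]/(f₃₀)`**: every non-zero ideal is in the class of one of
`⟨Θ - 1, 1⟩`, `⟨Θ - 2, 5⟩`, `⟨Θ - 15, 17⟩`, `⟨Θ - 8, 11⟩`, `⟨Θ - 4, 7⟩`, `⟨Θ - 5, 13⟩`, `⟨Θ - 9, 11⟩`, `⟨Θ - 2, 11⟩` (these representatives cover `C(ℤ[Θ₃₀])`). [cite: KimYamada2023, §6.1 (proof of Thm. B)] -/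
theorem ideal_class_adjoinRoot_thirty (J : Ideal (AdjoinRoot (csPoly 30))) (hJ : J ≠ ⊥) :
    ∃ x y : AdjoinRoot (csPoly 30), x ≠ 0 ∧ y ≠ 0 ∧
      (span {x} * J = span {y} * csIdeal 1 1 30 ∨ span {x} * J = span {y} * csIdeal 2 5 30 ∨ span {x} * J = span {y} * csIdeal 15 17 30 ∨ span {x} * J = span {y} * csIdeal 8 11 30 ∨ span {x} * J = span {y} * csIdeal 4 7 30 ∨ span {x} * J = span {y} * csIdeal 5 13 30 ∨ span {x} * J = span {y} * csIdeal 9 11 30 ∨ span {x} * J = span {y} * csIdeal 2 11 30) := by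
  classical
  set θ' := AdjoinRoot.root (csPolyQ 30) with hθ'
  have hθ : aeval θ' (csPoly 30) = 0 := aeval_root_csPoly 30
  have h3 : finrank ℚ (CSField 30) = 3 := finrank_CSField 30
  obtain ⟨e, he⟩ := exists_ringEquiv_adjoinRoot_of_sq hθ h3 csDisc_thirty_sq
  set I : Ideal (𝓞 (CSField 30)) := J.map e with hI
  have hIJ : I.map (e.symm : 𝓞 (CSField 30) →+* AdjoinRoot (csPoly 30)) = J := by
    rw [hI]
    exact Ideal.map_of_equiv e (I := J)
  have hI0 : I ≠ ⊥ := by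
    intro h0
    apply hJ
    rw [← hIJ, h0, Ideal.map_bot]
  have hImem : I ∈ (Ideal (𝓞 (CSField 30)))⁰ := mem_nonZeroDivisors_iff_ne_zero.mpr hI0
  have hsymm : ∀ x, (e.symm : 𝓞 (CSField 30) →+* AdjoinRoot (csPoly 30)) (e x) = x :=
    fun x => e.symm_apply_apply x
  have hP5_2 : (span {(5 : 𝓞 (CSField 30)), thetaInt hθ - 2}).map
      (e.symm : 𝓞 (CSField 30) →+* AdjoinRoot (csPoly 30)) = csIdeal 2 5 30 := by
    rw [Ideal.map_span, Set.image_insert_eq, Set.image_singleton, map_sub, ← he, hsymm, map_ofNat,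
      map_ofNat, csIdeal, Set.pair_comm]
    simp
  have hP17_15 : (span {(17 : 𝓞 (CSField 30)), thetaInt hθ - 15}).map
      (e.symm : 𝓞 (CSField 30) →+* AdjoinRoot (csPoly 30)) = csIdeal 15 17 30 := by
    rw [Ideal.map_span, Set.image_insert_eq, Set.image_singleton, map_sub, ← he, hsymm, map_ofNat,
      map_ofNat, csIdeal, Set.pair_comm]
    simp
  have hP11_8 : (span {(11 : 𝓞 (CSField 30)), thetaInt hθ - 8}).map
      (e.symm : 𝓞 (CSField 30) →+* AdjoinRoot (csPoly 30)) = csIdeal 8 11 30 := by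
    rw [Ideal.map_span, Set.image_insert_eq, Set.image_singleton, map_sub, ← he, hsymm, map_ofNat,
      map_ofNat, csIdeal, Set.pair_comm]
    simp
  have hP7_4 : (span {(7 : 𝓞 (CSField 30)), thetaInt hθ - 4}).map
      (e.symm : 𝓞 (CSField 30) →+* AdjoinRoot (csPoly 30)) = csIdeal 4 7 30 := by
    rw [Ideal.map_span, Set.image_insert_eq, Set.image_singleton, map_sub, ← he, hsymm, map_ofNat,
      map_ofNat, csIdeal, Set.pair_comm]
    simp
  have hP13_5 : (span {(13 : 𝓞 (CSField 30)), thetaInt hθ - 5}).map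
      (e.symm : 𝓞 (CSField 30) →+* AdjoinRoot (csPoly 30)) = csIdeal 5 13 30 := by
    rw [Ideal.map_span, Set.image_insert_eq, Set.image_singleton, map_sub, ← he, hsymm, map_ofNat,
      map_ofNat, csIdeal, Set.pair_comm]
    simp
  have hP11_9 : (span {(11 : 𝓞 (CSField 30)), thetaInt hθ - 9}).map
      (e.symm : 𝓞 (CSField 30) →+* AdjoinRoot (csPoly 30)) = csIdeal 9 11 30 := by
    rw [Ideal.map_span, Set.image_insert_eq, Set.image_singleton, map_sub, ← he, hsymm, map_ofNat,
      map_ofNat, csIdeal, Set.pair_comm]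
    simp
  have hP11_2 : (span {(11 : 𝓞 (CSField 30)), thetaInt hθ - 2}).map
      (e.symm : 𝓞 (CSField 30) →+* AdjoinRoot (csPoly 30)) = csIdeal 2 11 30 := by
    rw [Ideal.map_span, Set.image_insert_eq, Set.image_singleton, map_sub, ← he, hsymm, map_ofNat,
      map_ofNat, csIdeal, Set.pair_comm]
    simp
  have hcase : ∀ (P : Ideal (𝓞 (CSField 30))) (hP0 : P ∈ (Ideal (𝓞 (CSField 30)))⁰)
      (Q : Ideal (AdjoinRoot (csPoly 30))),
      P.map (e.symm : 𝓞 (CSField 30) →+* AdjoinRoot (csPoly 30)) = Q →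
      ClassGroup.mk0 ⟨I, hImem⟩ = ClassGroup.mk0 ⟨P, hP0⟩ →
        ∃ x y : AdjoinRoot (csPoly 30), x ≠ 0 ∧ y ≠ 0 ∧ span {x} * J = span {y} * Q := by
    intro P hP0 Q hPQ hcls
    obtain ⟨x, y, hx, hy, hxy⟩ := ClassGroup.mk0_eq_mk0_iff.mp hcls
    refine ⟨(e.symm : 𝓞 (CSField 30) →+* AdjoinRoot (csPoly 30)) x,
      (e.symm : 𝓞 (CSField 30) →+* AdjoinRoot (csPoly 30)) y,
      (map_ne_zero_iff _ e.symm.injective).mpr hx, (map_ne_zero_iff _ e.symm.injective).mpr hy, ?_⟩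
    have h := congrArg (Ideal.map (e.symm : 𝓞 (CSField 30) →+* AdjoinRoot (csPoly 30))) hxy
    simp only [Ideal.map_mul, Ideal.map_span, Set.image_singleton] at h
    rw [hIJ, hPQ] at h
    exact h
  rcases classGroup_mem_thirty hθ h3 (ClassGroup.mk0 ⟨I, hImem⟩) with h1 | hcl | hcl | hcl | hcl | hcl | hcl | hcl
  · obtain ⟨z, hz⟩ := ((ClassGroup.mk0_eq_one_iff hImem).mp h1).principal
    have hz' : I = span {z} := by rw [hz, submodule_span_eq]
    have hz0 : z ≠ 0 := by
      rintro rfl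
      apply hI0
      rw [hz', Ideal.span_singleton_eq_bot]
    refine ⟨1, (e.symm : 𝓞 (CSField 30) →+* AdjoinRoot (csPoly 30)) z, one_ne_zero,
      (map_ne_zero_iff _ e.symm.injective).mpr hz0, Or.inl ?_⟩
    rw [Ideal.span_singleton_one, Ideal.top_mul, csIdeal_one_one, Ideal.mul_top, ← hIJ, hz',
      Ideal.map_span, Set.image_singleton]
  · obtain ⟨x, y, hx, hy, h⟩ := hcase _ _ _ hP5_2 hcl
    exact ⟨x, y, hx, hy, Or.inr (Or.inl h)⟩
  · obtain ⟨x, y, hx, hy, h⟩ := hcase _ _ _ hP17_15 hcl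
    exact ⟨x, y, hx, hy, Or.inr (Or.inr (Or.inl h))⟩
  · obtain ⟨x, y, hx, hy, h⟩ := hcase _ _ _ hP11_8 hcl
    exact ⟨x, y, hx, hy, Or.inr (Or.inr (Or.inr (Or.inl h)))⟩
  · obtain ⟨x, y, hx, hy, h⟩ := hcase _ _ _ hP7_4 hcl
    exact ⟨x, y, hx, hy, Or.inr (Or.inr (Or.inr (Or.inr (Or.inl h))))⟩
  · obtain ⟨x, y, hx, hy, h⟩ := hcase _ _ _ hP13_5 hcl
    exact ⟨x, y, hx, hy, Or.inr (Or.inr (Or.inr (Or.inr (Or.inr (Or.inl h)))))⟩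
  · obtain ⟨x, y, hx, hy, h⟩ := hcase _ _ _ hP11_9 hcl
    exact ⟨x, y, hx, hy, Or.inr (Or.inr (Or.inr (Or.inr (Or.inr (Or.inr (Or.inl h))))))⟩
  · obtain ⟨x, y, hx, hy, h⟩ := hcase _ _ _ hP11_2 hcl
    exact ⟨x, y, hx, hy, Or.inr (Or.inr (Or.inr (Or.inr (Or.inr (Or.inr (Or.inr (h)))))))⟩

/-- `5 ∣ f₃₀(2)`: `(2, 5, 30) ∈ 𝒞𝒮`. [cite: KimYamada2023, §6.1 (proof of Thm. B)] -/
theorem rep0_dvd_eval_csPoly_thirty : (5 : ℤ) ∣ (csPoly 30).eval 2 := by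
  rw [eval_csPoly]; norm_num

/-- `17 ∣ f₃₀(15)`: `(15, 17, 30) ∈ 𝒞𝒮`. [cite: KimYamada2023, §6.1 (proof of Thm. B)] -/
theorem rep1_dvd_eval_csPoly_thirty : (17 : ℤ) ∣ (csPoly 30).eval 15 := by
  rw [eval_csPoly]; norm_num

/-- `11 ∣ f₃₀(8)`: `(8, 11, 30) ∈ 𝒞𝒮`. [cite: KimYamada2023, §6.1 (proof of Thm. B)] -/
theorem rep2_dvd_eval_csPoly_thirty : (11 : ℤ) ∣ (csPoly 30).eval 8 := by
  rw [eval_csPoly]; norm_num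

/-- `7 ∣ f₃₀(4)`: `(4, 7, 30) ∈ 𝒞𝒮`. [cite: KimYamada2023, §6.1 (proof of Thm. B)] -/
theorem rep3_dvd_eval_csPoly_thirty : (7 : ℤ) ∣ (csPoly 30).eval 4 := by
  rw [eval_csPoly]; norm_num

/-- `13 ∣ f₃₀(5)`: `(5, 13, 30) ∈ 𝒞𝒮`. [cite: KimYamada2023, §6.1 (proof of Thm. B)] -/
theorem rep4_dvd_eval_csPoly_thirty : (13 : ℤ) ∣ (csPoly 30).eval 5 := by
  rw [eval_csPoly]; norm_num

/-- `11 ∣ f₃₀(9)`: `(9, 11, 30) ∈ 𝒞𝒮`. [cite: KimYamada2023, §6.1 (proof of Thm. B)] -/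
theorem rep5_dvd_eval_csPoly_thirty : (11 : ℤ) ∣ (csPoly 30).eval 9 := by
  rw [eval_csPoly]; norm_num

/-- `11 ∣ f₃₀(2)`: `(2, 11, 30) ∈ 𝒞𝒮`. [cite: KimYamada2023, §6.1 (proof of Thm. B)] -/
theorem rep6_dvd_eval_csPoly_thirty : (11 : ℤ) ∣ (csPoly 30).eval 2 := by
  rw [eval_csPoly]; norm_num

/-- **Every Cappell–Shaneson matrix of trace `30` is similar to one of 8 standard matrices**
(Prop. 2.14). [cite: KimYamada2023, §6.1 (proof of Thm. B) and Prop. 2.14] -/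
theorem isConj_standardCSMatrix_of_trace_eq_thirty (A : SL(3, ℤ))
    (hdet : ((A : Matrix (Fin 3) (Fin 3) ℤ) - 1).det = 1)
    (htr : Matrix.trace (A : Matrix (Fin 3) (Fin 3) ℤ) = 30) :
    IsConj A (standardCSMatrix 1 1 30 (one_dvd _)) ∨
      IsConj A (standardCSMatrix 2 5 30 rep0_dvd_eval_csPoly_thirty) ∨
      IsConj A (standardCSMatrix 15 17 30 rep1_dvd_eval_csPoly_thirty) ∨
      IsConj A (standardCSMatrix 8 11 30 rep2_dvd_eval_csPoly_thirty) ∨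
      IsConj A (standardCSMatrix 4 7 30 rep3_dvd_eval_csPoly_thirty) ∨
      IsConj A (standardCSMatrix 5 13 30 rep4_dvd_eval_csPoly_thirty) ∨
      IsConj A (standardCSMatrix 9 11 30 rep5_dvd_eval_csPoly_thirty) ∨
      IsConj A (standardCSMatrix 2 11 30 rep6_dvd_eval_csPoly_thirty) := by
  have hcover : ∀ J : Ideal (AdjoinRoot (csPoly 30)), J ≠ ⊥ →
      ∃ (c d : ℤ) (_ : d ∣ (csPoly 30).eval c) (x y : AdjoinRoot (csPoly 30)),
        x ≠ 0 ∧ y ≠ 0 ∧ Ideal.span {x} * J = Ideal.span {y} * csIdeal c d 30 ∧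
          ((c = 1 ∧ d = 1) ∨ (c = 2 ∧ d = 5) ∨ (c = 15 ∧ d = 17) ∨ (c = 8 ∧ d = 11) ∨ (c = 4 ∧ d = 7) ∨ (c = 5 ∧ d = 13) ∨ (c = 9 ∧ d = 11) ∨ (c = 2 ∧ d = 11)) := by
    intro J hJ
    obtain ⟨x, y, hx, hy, hxy⟩ := ideal_class_adjoinRoot_thirty J hJ
    rcases hxy with h0 | h1 | h2 | h3 | h4 | h5 | h6 | h7
    · exact ⟨1, 1, one_dvd _, x, y, hx, hy, h0, Or.inl ⟨rfl, rfl⟩⟩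
    · exact ⟨2, 5, rep0_dvd_eval_csPoly_thirty, x, y, hx, hy, h1, Or.inr (Or.inl ⟨rfl, rfl⟩)⟩
    · exact ⟨15, 17, rep1_dvd_eval_csPoly_thirty, x, y, hx, hy, h2, Or.inr (Or.inr (Or.inl ⟨rfl, rfl⟩))⟩
    · exact ⟨8, 11, rep2_dvd_eval_csPoly_thirty, x, y, hx, hy, h3, Or.inr (Or.inr (Or.inr (Or.inl ⟨rfl, rfl⟩)))⟩
    · exact ⟨4, 7, rep3_dvd_eval_csPoly_thirty, x, y, hx, hy, h4, Or.inr (Or.inr (Or.inr (Or.inr (Or.inl ⟨rfl, rfl⟩))))⟩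
    · exact ⟨5, 13, rep4_dvd_eval_csPoly_thirty, x, y, hx, hy, h5, Or.inr (Or.inr (Or.inr (Or.inr (Or.inr (Or.inl ⟨rfl, rfl⟩)))))⟩
    · exact ⟨9, 11, rep5_dvd_eval_csPoly_thirty, x, y, hx, hy, h6, Or.inr (Or.inr (Or.inr (Or.inr (Or.inr (Or.inr (Or.inl ⟨rfl, rfl⟩))))))⟩
    · exact ⟨2, 11, rep6_dvd_eval_csPoly_thirty, x, y, hx, hy, h7, Or.inr (Or.inr (Or.inr (Or.inr (Or.inr (Or.inr (Or.inr (⟨rfl, rfl⟩)))))))⟩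
  obtain ⟨c, d, h, hconj, hcd⟩ := exists_isConj_standardCSMatrix_of_cover _ hcover A hdet htr
  rcases hcd with ⟨rfl, rfl⟩ | ⟨rfl, rfl⟩ | ⟨rfl, rfl⟩ | ⟨rfl, rfl⟩ | ⟨rfl, rfl⟩ | ⟨rfl, rfl⟩ | ⟨rfl, rfl⟩ | ⟨rfl, rfl⟩
  · exact Or.inl hconj
  · exact Or.inr (Or.inl hconj)
  · exact Or.inr (Or.inr (Or.inl hconj))
  · exact Or.inr (Or.inr (Or.inr (Or.inl hconj)))
  · exact Or.inr (Or.inr (Or.inr (Or.inr (Or.inl hconj))))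
  · exact Or.inr (Or.inr (Or.inr (Or.inr (Or.inr (Or.inl hconj)))))
  · exact Or.inr (Or.inr (Or.inr (Or.inr (Or.inr (Or.inr (Or.inl hconj))))))
  · exact Or.inr (Or.inr (Or.inr (Or.inr (Or.inr (Or.inr (Or.inr (hconj)))))))

/-- **Kim–Yamada 2023, Theorem B for the trace `30`, PROVED**: the non-trivial classes move by
Gompf moves to the traces `0` (from `(2, 5, 30)`), `-4` (from `(15, 17, 30)`), `-3` (from `(8, 11, 30)`), `2` (from `(4, 7, 30)`), `4` (from `(5, 13, 30)`), `-3` (from `(9, 11, 30)`), `-3` (from `(2, 11, 30)`), where Gompf's conjecture holds. [cite: KimYamada2023, Thm. B, Lemma 6.1 and §6.1] -/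
theorem gompfConjectureForTrace_thirty : GompfConjectureForTrace 30 := by
  intro A hdet htr
  rcases isConj_standardCSMatrix_of_trace_eq_thirty A hdet htr with h0 | h1 | h2 | h3 | h4 | h5 | h6 | h7
  · exact (GompfEquiv.of_isConj h0).trans (gompfEquiv_standardCSMatrix_one_one 28 (one_dvd _))
  · exact (GompfEquiv.of_isConj h1).trans
      (gompfEquiv_standardCSMatrix_akbulutKirbyMatrix_of_modEq
        (gompfConjectureForTrace_of_mem_Icc_neg_seven_twelve (by norm_num)) rep0_dvd_eval_csPoly_thirty
        (show (30 : ℤ) ≡ 0 [ZMOD 5] by decide))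
  · exact (GompfEquiv.of_isConj h2).trans
      (gompfEquiv_standardCSMatrix_akbulutKirbyMatrix_of_modEq
        (gompfConjectureForTrace_of_mem_Icc_neg_seven_twelve (by norm_num)) rep1_dvd_eval_csPoly_thirty
        (show (30 : ℤ) ≡ -4 [ZMOD 17] by decide))
  · exact (GompfEquiv.of_isConj h3).trans
      (gompfEquiv_standardCSMatrix_akbulutKirbyMatrix_of_modEq
        (gompfConjectureForTrace_of_mem_Icc_neg_seven_twelve (by norm_num)) rep2_dvd_eval_csPoly_thirty
        (show (30 : ℤ) ≡ -3 [ZMOD 11] by decide))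
  · exact (GompfEquiv.of_isConj h4).trans
      (gompfEquiv_standardCSMatrix_akbulutKirbyMatrix_of_modEq
        (gompfConjectureForTrace_of_mem_Icc_neg_seven_twelve (by norm_num)) rep3_dvd_eval_csPoly_thirty
        (show (30 : ℤ) ≡ 2 [ZMOD 7] by decide))
  · exact (GompfEquiv.of_isConj h5).trans
      (gompfEquiv_standardCSMatrix_akbulutKirbyMatrix_of_modEq
        (gompfConjectureForTrace_of_mem_Icc_neg_seven_twelve (by norm_num)) rep4_dvd_eval_csPoly_thirty
        (show (30 : ℤ) ≡ 4 [ZMOD 13] by decide))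
  · exact (GompfEquiv.of_isConj h6).trans
      (gompfEquiv_standardCSMatrix_akbulutKirbyMatrix_of_modEq
        (gompfConjectureForTrace_of_mem_Icc_neg_seven_twelve (by norm_num)) rep5_dvd_eval_csPoly_thirty
        (show (30 : ℤ) ≡ -3 [ZMOD 11] by decide))
  · exact (GompfEquiv.of_isConj h7).trans
      (gompfEquiv_standardCSMatrix_akbulutKirbyMatrix_of_modEq
        (gompfConjectureForTrace_of_mem_Icc_neg_seven_twelve (by norm_num)) rep6_dvd_eval_csPoly_thirty
        (show (30 : ℤ) ≡ -3 [ZMOD 11] by decide))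

/-- **Theorem B for the trace `-25`** (`= 5 - 30`), by Theorem A. [cite: KimYamada2023, Thm. A and Thm. B] -/
theorem gompfConjectureForTrace_neg_twentyfive : GompfConjectureForTrace (-25) := by
  have h := gompfConjectureForTrace_of_five_sub gompfConjectureForTrace_thirty
  norm_num at h
  exact h

end Matrices


end Literature.Topology.FourManifolds

end
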